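import Summits.AnomalousDissipation.AnomalousDissipation.Theorems.SolenoidalFractalHomogenisationLagrangianStepSidebandLadderBounds
import Summits.AnomalousDissipation.AnomalousDissipation.Theorems.SolenoidalFractalHomogenisationLagrangianStepW7ThreeModeFibre
import HarnessLib

/-!
# K1L_D `stub_D1_V0thg` (stmt-AnomalousDissipation-27980), R3′ lane «SidebandTailCrushing» (tenure D28-16 (3) / D28-20) — file F4g:
# LADDER ODD ALLOWANCE — the odd-viscosity hypothesis h6 (`hodd`) of `Sideband.ladder_decay` from `Torus.OddSmall`

Helper file of route `SolenoidalFractalHomogenisation` (prover seat `ad-k1l-cellLawV-w1` g10; `--supports stmt-AnomalousDissipation-27980 --as helper`).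
* §1 `re_inner_symbT_sub_swap_le` — fibre level: for transversal `v, x` and `OddSmall 𝔹 β` (`β ≥ 0`),
  `Re⟪x, T_𝔹(k) v⟫ − Re⟪v, T_𝔹(k) x⟫ ≤ β·|k|²·‖v‖·‖x‖` (the antisymmetric part of the transverse symbol; `re_inner_symbT_bilin` + `OddSmall` on
  real and imaginary parts).
* §2 `real_inner_dampL_sub_swap_le` — ladder level: for `v, x ∈ ladderSub R L`,
  `⟪dampL v, x⟫_ℝ − ⟪dampL x, v⟫_ℝ ≤ 2π²β·(s⁻¹ Σ_z |z|²‖v_z‖² + s Σ_z |z|²‖x_z‖²)` for every `s > 0`; and the weighted bond bound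
  `Σ_z |z|²‖(C u)_z‖² ≤ 8a²(1+|mᵢ|²) Σ_w |w|²‖u_w‖²` (`sum_freqNormSq_mul_norm_sq_bond_le`, the sum behind `inner_dampL_bond_le`).
* §3 `ladder_odd_allowance` — EXACTLY the hypothesis `hodd` of `Sideband.ladder_decay` with
  `η₂ = β/(2lo')·(s⁻¹ + 8a²(1+|mᵢ|²)·s')`, `η₃ = β/(2lo')·(8a²(1+|mᵢ|²)·s + s'⁻¹)` (`s, s' > 0` free; `NearIso 𝔸 lo' hi'`, `lo' > 0`, `OddSmall 𝔸 β`).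
  For a major-symmetric viscosity `β = 0` and h6 is vacuous.  NOTE for the parameter choice (file F5, not here): P4d of the abstract lemma reads
  `8βₕη₃ ≤ α = S βₕ²`, so `s ~ βₕ`, `s' ~ βₕ⁻¹` and then P4c `16βₕη₂ ≤ 1` becomes a smallness condition on `β/lo'` (the sector `τ`) times `1 + 8a²(1+|mᵢ|²)`.
No definitions, no sorry.  NOT a proof of `stub_D1_V0thg`, of K1L_D or of AD; rung F-D1.A0 infrastructure.
-/

set_option linter.dupNamespace false -- single-conjunct summit: `Summit.AnomalousDissipation.AnomalousDissipation.…` is the mandated namespace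

noncomputable section

namespace Summit.AnomalousDissipation.AnomalousDissipation.Theorems.SolenoidalFractalHomogenisation.LagrangianStep.Sideband

open Set Complex
open scoped InnerProductSpace
open Literature.Analysis Literature.Analysis.FunctionSpaces Literature.Analysis.FunctionSpaces.Torus
open Literature.Analysis.FluidPDE Literature.Analysis.FluidPDE.Torus Literature.Analysis.FluidPDE.LatticeShear
open Summit.AnomalousDissipation.AnomalousDissipation.Theorems.SolenoidalFractalHomogenisation.LagrangianStep.CellChain
  (inner_transversalProj_left_of_kdot_eq_zero)
open Summit.AnomalousDissipation.AnomalousDissipation.Theorems.SolenoidalFractalHomogenisation.LagrangianStep.ThreeMode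
  (re_inner_symbT_bilin re_im_transversal norm_sq_re_im sqrt_mul_add_sqrt_mul_le abs_le_of_sq_le_sq'')

variable {k₀ : ℕ}

/-! ## §1 Fibre level: the antisymmetric part of the transverse symbol -/

/-- The odd part of the bilinear symbol, linearly: `β_𝔹(k;p,q) − β_𝔹(k;q,p) ≤ β·|k|²·|p|·|q|` for transversal `p, q` (`OddSmall 𝔹 β`, `β ≥ 0`).
[cite: Avron1998OddViscosity, §2 eq. (1)-(2)] -/
theorem bsymb_sub_swap_le {𝔹 : Torus.Visc4 (Fin 3)} {β : ℝ} (hodd : Torus.OddSmall 𝔹 β) (hβ : 0 ≤ β) (k p q : Fin 3 → ℝ)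
    (hp : ∑ i, p i * k i = 0) (hq : ∑ i, q i * k i = 0) :
    Torus.bsymb 𝔹 k p q - Torus.bsymb 𝔹 k q p ≤ β * (∑ a, k a ^ 2) * (Real.sqrt (∑ i, p i ^ 2) * Real.sqrt (∑ i, q i ^ 2)) := by
  have hP2 : 0 ≤ ∑ i, p i ^ 2 := by positivity
  have hQ2 : 0 ≤ ∑ i, q i ^ 2 := by positivity
  have hSP := Real.sq_sqrt hP2
  have hSQ := Real.sq_sqrt hQ2
  have h := hodd k p q hp hq
  refine (le_abs_self _).trans (abs_le_of_sq_le_sq'' ?_ (by positivity))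
  calc (Torus.bsymb 𝔹 k p q - Torus.bsymb 𝔹 k q p) ^ 2
      ≤ β ^ 2 * ((∑ a, k a ^ 2) ^ 2 * ((∑ i, p i ^ 2) * (∑ i, q i ^ 2))) := h
    _ = (β * (∑ a, k a ^ 2) * (Real.sqrt (∑ i, p i ^ 2) * Real.sqrt (∑ i, q i ^ 2))) ^ 2 := by
        rw [show (β * (∑ a, k a ^ 2) * (Real.sqrt (∑ i, p i ^ 2) * Real.sqrt (∑ i, q i ^ 2))) ^ 2
            = β ^ 2 * (∑ a, k a ^ 2) ^ 2 * (Real.sqrt (∑ i, p i ^ 2) ^ 2 * Real.sqrt (∑ i, q i ^ 2) ^ 2) by ring, hSP, hSQ]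
        ring

/-- **The antisymmetric part of the transverse symbol on complex transversal vectors**:
`Re⟪x, T_𝔹(k) v⟫ − Re⟪v, T_𝔹(k) x⟫ ≤ β·|k|²·‖v‖·‖x‖` (`OddSmall 𝔹 β`, `β ≥ 0`, `k·v = k·x = 0`). [cite: Avron1998OddViscosity, §2 eq. (1)-(2)] -/
theorem re_inner_symbT_sub_swap_le {𝔹 : Torus.Visc4 (Fin 3)} {β : ℝ} (hodd : Torus.OddSmall 𝔹 β) (hβ : 0 ≤ β) (k : Fin 3 → ℤ)
    {v x : EuclideanSpace ℂ (Fin 3)} (hv : kdot k v = 0) (hx : kdot k x = 0) :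
    (⟪x, Torus.symbT 𝔹 k v⟫_ℂ).re - (⟪v, Torus.symbT 𝔹 k x⟫_ℂ).re ≤ β * freqNormSq k * (‖v‖ * ‖x‖) := by
  obtain ⟨hvr, hvi⟩ := re_im_transversal hv
  obtain ⟨hxr, hxi⟩ := re_im_transversal hx
  have hK : (∑ a, ((fun a => (k a : ℝ)) a) ^ 2) = freqNormSq k := by simp [freqNormSq]
  have h1 := bsymb_sub_swap_le hodd hβ (fun a => (k a : ℝ)) (fun i => (v i).re) (fun j => (x j).re) hvr hxr
  have h2 := bsymb_sub_swap_le hodd hβ (fun a => (k a : ℝ)) (fun i => (v i).im) (fun j => (x j).im) hvi hxi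
  rw [hK] at h1 h2
  have hcs := sqrt_mul_add_sqrt_mul_le (a := ∑ i, (v i).re ^ 2) (b := ∑ i, (v i).im ^ 2)
    (c := ∑ i, (x i).re ^ 2) (d := ∑ i, (x i).im ^ 2) (by positivity) (by positivity) (by positivity) (by positivity)
  have hvn : Real.sqrt (∑ i, (v i).re ^ 2 + ∑ i, (v i).im ^ 2) = ‖v‖ := by rw [← norm_sq_re_im, Real.sqrt_sq (norm_nonneg _)]
  have hxn : Real.sqrt (∑ i, (x i).re ^ 2 + ∑ i, (x i).im ^ 2) = ‖x‖ := by rw [← norm_sq_re_im, Real.sqrt_sq (norm_nonneg _)]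
  rw [hvn, hxn] at hcs
  rw [re_inner_symbT_bilin, re_inner_symbT_bilin]
  have hc : 0 ≤ β * freqNormSq k := mul_nonneg hβ (freqNormSq_nonneg k)
  have := mul_le_mul_of_nonneg_left hcs hc
  linarith

/-! ## §2 Ladder level -/

/-- The damping form between two states of a ladder subspace, fibrewise: `Re⟪(dampL v)_z, x_z⟫ = 4π²·Re⟪x_z, T_{𝔸ᵀ}(z) v_z⟫`.
[cite: MajdaKramer1999, §2.2.1.3 (cell problem (49))] -/
theorem re_inner_dampL_apply₂ {R : ℕ} {L : Set (Fin 3 → ℤ)} (𝔸 : Torus.Visc4 (Fin 3)) (γ₁ : ℝ) {v x : Space R} (hv : v ∈ ladderSub R L)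
    (hx : x ∈ ladderSub R L) (z : box R) :
    (⟪dampL 𝔸 γ₁ R v z, x z⟫_ℂ).re = 4 * Real.pi ^ 2 * (⟪x z, Torus.symbT (Torus.majorTranspose 𝔸) z.1 (v z)⟫_ℂ).re := by
  have hP := transversalProj_apply_of_mem_ladderSub hv z
  have hk := kdot_eq_zero_of_mem_ladderSub hx z
  rw [dampL_apply, dampComp_apply, hP, sub_self, smul_zero, add_zero, inner_smul_left, Complex.conj_ofReal, Complex.re_ofReal_mul,
    inner_transversalProj_left_of_kdot_eq_zero z.1 hk, ← inner_conj_symm, Complex.conj_re]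

/-- Young's inequality in the form used below: `2·a·b ≤ s⁻¹·a² + s·b²` (`s > 0`). -/
theorem two_mul_le_inv_mul_sq_add (a b : ℝ) {s : ℝ} (hs : 0 < s) : 2 * (a * b) ≤ s⁻¹ * a ^ 2 + s * b ^ 2 := by
  have h : 0 ≤ (a - s * b) ^ 2 := sq_nonneg _
  have e : s⁻¹ * a ^ 2 + s * b ^ 2 - 2 * (a * b) = s⁻¹ * (a - s * b) ^ 2 := by field_simp; ring
  have : 0 ≤ s⁻¹ * (a - s * b) ^ 2 := mul_nonneg (inv_nonneg.2 hs.le) h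
  linarith

/-- **The antisymmetric part of the damping form on a ladder subspace**: for `v, x ∈ ladderSub R L`, `OddSmall 𝔸 β` (`β ≥ 0`) and `s > 0`,
`⟪dampL v, x⟫_ℝ − ⟪dampL x, v⟫_ℝ ≤ 2π²β·(s⁻¹·Σ_z |z|²‖v_z‖² + s·Σ_z |z|²‖x_z‖²)`. [cite: Avron1998OddViscosity, §2 eq. (1)-(2)] -/
theorem real_inner_dampL_sub_swap_le {R : ℕ} {L : Set (Fin 3 → ℤ)} {𝔸 : Torus.Visc4 (Fin 3)} {β : ℝ} (hodd : Torus.OddSmall 𝔸 β) (hβ : 0 ≤ β)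
    (γ₁ : ℝ) {v x : Space R} (hv : v ∈ ladderSub R L) (hx : x ∈ ladderSub R L) {s : ℝ} (hs : 0 < s) :
    ⟪dampL 𝔸 γ₁ R v, x⟫_ℝ - ⟪dampL 𝔸 γ₁ R x, v⟫_ℝ ≤
      2 * Real.pi ^ 2 * β * (s⁻¹ * ∑ z : box R, freqNormSq z.1 * ‖v z‖ ^ 2 + s * ∑ z : box R, freqNormSq z.1 * ‖x z‖ ^ 2) := by
  have hoddT : Torus.OddSmall (Torus.majorTranspose 𝔸) β := hodd.majorTranspose
  rw [real_inner_space_eq_sum, real_inner_space_eq_sum, Finset.mul_sum, Finset.mul_sum, ← Finset.sum_sub_distrib, mul_add,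
    Finset.mul_sum, Finset.mul_sum, ← Finset.sum_add_distrib]
  refine Finset.sum_le_sum fun z _ => ?_
  rw [re_inner_dampL_apply₂ 𝔸 γ₁ hv hx z, re_inner_dampL_apply₂ 𝔸 γ₁ hx hv z, ← mul_sub]
  have h1 := re_inner_symbT_sub_swap_le hoddT hβ z.1 (kdot_eq_zero_of_mem_ladderSub hv z) (kdot_eq_zero_of_mem_ladderSub hx z)
  have h2 := two_mul_le_inv_mul_sq_add ‖v z‖ ‖x z‖ hs
  have hF := freqNormSq_nonneg z.1
  have h3 : β * freqNormSq z.1 * (‖v z‖ * ‖x z‖) ≤ β * freqNormSq z.1 * ((s⁻¹ * ‖v z‖ ^ 2 + s * ‖x z‖ ^ 2) / 2) :=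
    mul_le_mul_of_nonneg_left (by linarith) (mul_nonneg hβ hF)
  have h4 := mul_le_mul_of_nonneg_left (h1.trans h3) (by positivity : (0:ℝ) ≤ 4 * Real.pi ^ 2)
  have e : 4 * Real.pi ^ 2 * (β * freqNormSq z.1 * ((s⁻¹ * ‖v z‖ ^ 2 + s * ‖x z‖ ^ 2) / 2)) =
      2 * Real.pi ^ 2 * β * (s⁻¹ * (freqNormSq z.1 * ‖v z‖ ^ 2)) + 2 * Real.pi ^ 2 * β * (s * (freqNormSq z.1 * ‖x z‖ ^ 2)) := by ring
  linarith

/-- **The weighted bond bound** `Σ_z |z|²‖(K hopL u − hopL K u)_z‖² ≤ 8a²(1+|mᵢ|²)·Σ_w |w|²‖u_w‖²` on the ladder subspace (the sum behind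
`inner_dampL_bond_le`). [cite: BedrossianCotiZelati2017, §2] -/
theorem sum_freqNormSq_mul_norm_sq_bond_le (W₁ : LatticeWord k₀) {R : ℕ} (i : Fin k₀) (z₀ : Fin 3 → ℤ) {u : Space R}
    (hu : u ∈ ladderSub R (ladder z₀ (W₁.phase i).m)) :
    ∑ z : box R, freqNormSq z.1 * ‖(indexL R (W₁.phase i).m (hopL W₁ R i u) - hopL W₁ R i (indexL R (W₁.phase i).m u)) z‖ ^ 2 ≤
      8 * (2 * Real.pi * |∑ a, (W₁.phase i).e a * (z₀ a : ℝ)| * ‖slotAmp W₁ i‖) ^ 2 * (1 + freqNormSq (W₁.phase i).m) *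
        ∑ w : box R, freqNormSq w.1 * ‖u w‖ ^ 2 := by
  have hM := freqNormSq_nonneg (W₁.phase i).m
  have ha2 : 0 ≤ 4 * (2 * Real.pi * |∑ a, (W₁.phase i).e a * (z₀ a : ℝ)| * ‖slotAmp W₁ i‖) ^ 2 * (1 + freqNormSq (W₁.phase i).m) := by
    positivity
  refine (Finset.sum_le_sum fun z _ => freqNormSq_mul_norm_sq_bond_apply_le W₁ i z₀ hu z).trans ?_
  rw [← Finset.mul_sum, Finset.sum_add_distrib]
  have h1 := sum_weight_norm_sq_coordL_sub_le (R := R) (fun w => freqNormSq w) (fun w => freqNormSq_nonneg w) (W₁.phase i).m u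
  have h2 := sum_weight_norm_sq_coordL_add_le (R := R) (fun w => freqNormSq w) (fun w => freqNormSq_nonneg w) (W₁.phase i).m u
  have := mul_le_mul_of_nonneg_left (add_le_add h1 h2) ha2
  linarith

/-! ## §3 The odd allowance h6 of `ladder_decay` -/

set_option maxHeartbeats 400000 in -- pre-budgeted (ops-buildfix rule)
/-- **LADDER ODD ALLOWANCE (h6 of `Sideband.ladder_decay`).**  With `K = indexL`, `C = K hopL − hopL K`, `D = dampL`, for `y ∈ ladderSub R (ladder z₀ mᵢ)`,
`NearIso 𝔸 lo' hi'` (`lo' > 0`), `OddSmall 𝔸 β` (`β ≥ 0`) and free `s, s' > 0`: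
`(⟪D y, C K y⟫ − ⟪D C K y, y⟫) + (⟪D K y, C y⟫ − ⟪D C y, K y⟫) ≤ η₂⟪D y, y⟫ + η₃⟪D K y, K y⟫`,
`η₂ = β/(2lo')·(s⁻¹ + 8a²(1+|mᵢ|²)s')`, `η₃ = β/(2lo')·(8a²(1+|mᵢ|²)s + s'⁻¹)`, `a = 2π|Σ eᵢ z₀|‖αᵢ‖`. [cite: Avron1998OddViscosity, §2 eq. (1)-(2)] -/
theorem ladder_odd_allowance (W₁ : LatticeWord k₀) {R : ℕ} (i : Fin k₀) (z₀ : Fin 3 → ℤ) {𝔸 : Torus.Visc4 (Fin 3)} {lo' hi' β : ℝ}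
    (h𝔸 : Torus.NearIso 𝔸 lo' hi') (hlo' : 0 < lo') (hodd : Torus.OddSmall 𝔸 β) (hβ : 0 ≤ β) (γ₁ : ℝ) {s s' : ℝ} (hs : 0 < s) (hs' : 0 < s')
    {y : Space R} (hy : y ∈ ladderSub R (ladder z₀ (W₁.phase i).m)) :
    (⟪dampL 𝔸 γ₁ R y, (indexL R (W₁.phase i).m (hopL W₁ R i (indexL R (W₁.phase i).m y)) -
        hopL W₁ R i (indexL R (W₁.phase i).m (indexL R (W₁.phase i).m y)))⟫_ℝ -
      ⟪dampL 𝔸 γ₁ R (indexL R (W₁.phase i).m (hopL W₁ R i (indexL R (W₁.phase i).m y)) -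
        hopL W₁ R i (indexL R (W₁.phase i).m (indexL R (W₁.phase i).m y))), y⟫_ℝ) +
    (⟪dampL 𝔸 γ₁ R (indexL R (W₁.phase i).m y), indexL R (W₁.phase i).m (hopL W₁ R i y) - hopL W₁ R i (indexL R (W₁.phase i).m y)⟫_ℝ -
      ⟪dampL 𝔸 γ₁ R (indexL R (W₁.phase i).m (hopL W₁ R i y) - hopL W₁ R i (indexL R (W₁.phase i).m y)), indexL R (W₁.phase i).m y⟫_ℝ) ≤
    β / (2 * lo') * (s⁻¹ + 8 * (2 * Real.pi * |∑ a, (W₁.phase i).e a * (z₀ a : ℝ)| * ‖slotAmp W₁ i‖) ^ 2 * (1 + freqNormSq (W₁.phase i).m) * s') *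
        ⟪dampL 𝔸 γ₁ R y, y⟫_ℝ +
      β / (2 * lo') * (8 * (2 * Real.pi * |∑ a, (W₁.phase i).e a * (z₀ a : ℝ)| * ‖slotAmp W₁ i‖) ^ 2 * (1 + freqNormSq (W₁.phase i).m) * s + s'⁻¹) *
        ⟪dampL 𝔸 γ₁ R (indexL R (W₁.phase i).m y), indexL R (W₁.phase i).m y⟫_ℝ := by
  obtain ⟨a, ha⟩ : ∃ a : ℝ, a = 2 * Real.pi * |∑ a, (W₁.phase i).e a * (z₀ a : ℝ)| * ‖slotAmp W₁ i‖ := ⟨_, rfl⟩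
  rw [← ha]
  have hKy := indexL_mem_ladderSub (W₁.phase i).m hy
  have hCy := bond_mem_ladderSub_ladder W₁ i z₀ hy
  have hCKy := bond_mem_ladderSub_ladder W₁ i z₀ hKy
  -- the two antisymmetric brackets
  have A1 := real_inner_dampL_sub_swap_le hodd hβ γ₁ hy hCKy hs
  have A2 := real_inner_dampL_sub_swap_le hodd hβ γ₁ hKy hCy hs'
  -- the weighted sums: bonds by their arguments, arguments by the damping form
  have B1 := sum_freqNormSq_mul_norm_sq_bond_le W₁ i z₀ hKy
  have B2 := sum_freqNormSq_mul_norm_sq_bond_le W₁ i z₀ hy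
  rw [← ha] at B1 B2
  have D1 := real_inner_dampL_ge h𝔸 γ₁ hy
  have D2 := real_inner_dampL_ge h𝔸 γ₁ hKy
  set Qy := ∑ z : box R, freqNormSq z.1 * ‖y z‖ ^ 2 with hQy
  set QK := ∑ z : box R, freqNormSq z.1 * ‖(indexL R (W₁.phase i).m y) z‖ ^ 2 with hQK
  set QC := ∑ z : box R, freqNormSq z.1 * ‖(indexL R (W₁.phase i).m (hopL W₁ R i y) - hopL W₁ R i (indexL R (W₁.phase i).m y)) z‖ ^ 2
    with hQC
  set QCK := ∑ z : box R, freqNormSq z.1 * ‖(indexL R (W₁.phase i).m (hopL W₁ R i (indexL R (W₁.phase i).m y)) -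
    hopL W₁ R i (indexL R (W₁.phase i).m (indexL R (W₁.phase i).m y))) z‖ ^ 2 with hQCK
  set Dy := ⟪dampL 𝔸 γ₁ R y, y⟫_ℝ with hDy
  set DK := ⟪dampL 𝔸 γ₁ R (indexL R (W₁.phase i).m y), indexL R (W₁.phase i).m y⟫_ℝ with hDK
  set M := 8 * a ^ 2 * (1 + freqNormSq (W₁.phase i).m) with hMdef
  have hM0 : 0 ≤ M := by have := freqNormSq_nonneg (W₁.phase i).m; positivity
  have hQy0 : 0 ≤ Qy := Finset.sum_nonneg fun w _ => mul_nonneg (freqNormSq_nonneg _) (sq_nonneg _)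
  have hQK0 : 0 ≤ QK := Finset.sum_nonneg fun w _ => mul_nonneg (freqNormSq_nonneg _) (sq_nonneg _)
  -- Qy ≤ Dy/(4π²lo'), QK ≤ DK/(4π²lo')
  have hπ : 0 < 4 * Real.pi ^ 2 * lo' := by positivity
  have hQy1 : Qy ≤ Dy / (4 * Real.pi ^ 2 * lo') := by rw [le_div_iff₀ hπ]; linarith
  have hQK1 : QK ≤ DK / (4 * Real.pi ^ 2 * lo') := by rw [le_div_iff₀ hπ]; linarith
  -- assemble
  have t1 : s⁻¹ * Qy + s * QCK ≤ s⁻¹ * (Dy / (4 * Real.pi ^ 2 * lo')) + s * (M * (DK / (4 * Real.pi ^ 2 * lo'))) := by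
    have u1 := mul_le_mul_of_nonneg_left hQy1 (inv_nonneg.2 hs.le)
    have u2 : QCK ≤ M * (DK / (4 * Real.pi ^ 2 * lo')) := B1.trans (mul_le_mul_of_nonneg_left hQK1 hM0)
    have u3 := mul_le_mul_of_nonneg_left u2 hs.le
    linarith
  have t2 : s'⁻¹ * QK + s' * QC ≤ s'⁻¹ * (DK / (4 * Real.pi ^ 2 * lo')) + s' * (M * (Dy / (4 * Real.pi ^ 2 * lo'))) := by
    have u1 := mul_le_mul_of_nonneg_left hQK1 (inv_nonneg.2 hs'.le)
    have u2 : QC ≤ M * (Dy / (4 * Real.pi ^ 2 * lo')) := B2.trans (mul_le_mul_of_nonneg_left hQy1 hM0)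
    have u3 := mul_le_mul_of_nonneg_left u2 hs'.le
    linarith
  have hc : 0 ≤ 2 * Real.pi ^ 2 * β := by positivity
  have v1 := mul_le_mul_of_nonneg_left t1 hc
  have v2 := mul_le_mul_of_nonneg_left t2 hc
  have e : 2 * Real.pi ^ 2 * β * (s⁻¹ * (Dy / (4 * Real.pi ^ 2 * lo')) + s * (M * (DK / (4 * Real.pi ^ 2 * lo')))) +
      2 * Real.pi ^ 2 * β * (s'⁻¹ * (DK / (4 * Real.pi ^ 2 * lo')) + s' * (M * (Dy / (4 * Real.pi ^ 2 * lo')))) =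
      β / (2 * lo') * (s⁻¹ + M * s') * Dy + β / (2 * lo') * (M * s + s'⁻¹) * DK := by
    field_simp
    ring
  linarith

end Summit.AnomalousDissipation.AnomalousDissipation.Theorems.SolenoidalFractalHomogenisation.LagrangianStep.Sideband

end
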